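import Summits.ValiantsHypothesis.ValiantsHypothesis.Theorems.BarrierLeverChowBenchmarkPairsGeneralNoGo

/-!
# Route BarrierLever — item 22038 `ChowBenchmarkPairs`, line `moore-peel`: the CROWDING no-go — a table containing the basis vectors
# of a coordinate set `C` admits at most `N_{C̄}` further points

Helper file (`--supports stmt-ValiantsHypothesis-22038`; cell valiant-natproofs, rung V4, 𝒟-side benchmark of record; seat val-np-p4 gen 20;
fourth of the no-go files after `…Hyperplane` (p633941), `…GeneralNoGo` (p634512), `…ZeonNoGo`).  Closes NO item; definition-free.

THE RULE (design rule R5, "top-region crowding").  Suppose the point table contains, for every coordinate `c` of a set `C`, the basis vector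
`e_c` as one of its points (`P (s c) = e_c`), and let `G` be a set of further points (not among the `s c`).  Let `N` be the number of benchmark
columns NOT contained in `C` (codes `< r` meeting a coordinate outside `C`).  If `|G| > N` the segment-moment matrix is singular
(`det_segMatrix_eq_zero_of_crowding`, `det_eq_zero_of_crowding`).  MECHANISM: for each `b ∈ G` the row combination
`w_b := Σ_{c∈C} P_{bc}·row{s c, b} − (1 + Σ_{c∈C} P_{bc})·row{b} + row ∅` vanishes at every column `T ⊆ C` (`crowding_combination_apply`; in the zeon
algebra `Σ_c P_{bc} y_c R_b = R_b − 1 − L_b^{C̄} R_b`), so the `|G|` independent combinations are crowded into the `N` columns outside `C`.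
This is the exact law behind the chain census of the g20 memo (§3bis): with `C` = all bits but the top one, the `(k−1)`-chains
`{e_0,…,e_{k−2}} + g generic points` have corank `max(0, g − N_top)` (kit j308240/1, j308650/1: h ≤ 56, equality every time; nonzero exactly at
h = 11, 32, 45), and with `C` = all bits (`N = 0`) every extra point kills the table (MEMO-g18-v5 §5.1's relation `R(1 − L) = 1`).

WHAT THIS IS NOT: a constraint on witnesses of the ∀h stubs only (for 0/1 designs: a design containing the singletons `{c}`, `c ∈ C`, has at most
`N_{C̄}` other points); no stub of the line is closed; nothing on items 20172 / 19717, crux stmt-ValiantsHypothesis-14610, or `VP` versus `VNP`.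
-/

set_option linter.dupNamespace false

namespace Summit.ValiantsHypothesis.ValiantsHypothesis.Theorems.BarrierLever.ChowBenchmarkHyperplane

open Finset Module
open Summit.ValiantsHypothesis.ValiantsHypothesis.Theorems.BarrierLever.MoorePeel (benchCols)

variable {h : ℕ}

noncomputable section

/-! ## 1. Pair rows against a basis vector -/

/-- A product over a nonempty set of the coordinates of the basis vector `e_c` vanishes unless the set is `{c}`… in particular it
vanishes as soon as the set has an element different from `c`. -/
theorem prod_basis_eq_zero (P : Fin h → Fin h → ℂ) {s c : Fin h} (hs : ∀ x, P s x = if x = c then 1 else 0)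
    {d : Finset (Fin h)} {x : Fin h} (hx : x ∈ d) (hxc : x ≠ c) : ∏ y ∈ d, P s y = 0 :=
  Finset.prod_eq_zero hx (by rw [hs x, if_neg hxc])

/-- **Pair row `{e_c, b}`**: `pairSum P s b T = |T|!·∏_{x∈T} P b x + [c ∈ T]·(|T|−1)!·∏_{x∈T∖c} P b x` when `P s = e_c`. -/
theorem pairSum_basis (P : Fin h → Fin h → ℂ) {s c : Fin h} (hs : ∀ x, P s x = if x = c then 1 else 0) (b : Fin h)
    (T : Finset (Fin h)) :
    pairSum P s b T = (T.card.factorial : ℂ) * ∏ x ∈ T, P b x +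
      (if c ∈ T then (((T.card - 1).factorial : ℕ) : ℂ) * ∏ x ∈ T.erase c, P b x else 0) := by
  classical
  unfold pairSum
  by_cases hcT : c ∈ T
  · rw [if_pos hcT]
    obtain ⟨T', hcT', rfl⟩ : ∃ T' : Finset (Fin h), c ∉ T' ∧ T = insert c T' :=
      ⟨T.erase c, Finset.notMem_erase c T, (Finset.insert_erase hcT).symm⟩
    rw [Finset.sum_powerset_insert hcT', Finset.erase_insert hcT', Finset.card_insert_of_notMem hcT', Nat.add_sub_cancel]
    have h1 : ∑ d ∈ T'.powerset, (d.card.factorial : ℂ) * (((insert c T') \ d).card.factorial : ℂ) *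
        ((∏ x ∈ d, P s x) * ∏ x ∈ (insert c T') \ d, P b x) =
        ((T'.card + 1).factorial : ℂ) * ∏ x ∈ insert c T', P b x := by
      rw [Finset.sum_eq_single_of_mem ∅ (Finset.empty_mem_powerset T')]
      · simp [Finset.card_insert_of_notMem hcT']
      · intro d hd hne
        obtain ⟨x, hx⟩ := Finset.nonempty_iff_ne_empty.mpr hne
        have hxc : x ≠ c := fun e => hcT' (e ▸ Finset.mem_powerset.mp hd hx)
        rw [prod_basis_eq_zero P hs hx hxc, zero_mul, mul_zero]
    have h2 : ∑ d ∈ T'.powerset, ((insert c d).card.factorial : ℂ) * (((insert c T') \ insert c d).card.factorial : ℂ) *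
        ((∏ x ∈ insert c d, P s x) * ∏ x ∈ (insert c T') \ insert c d, P b x) =
        ((T'.card.factorial : ℕ) : ℂ) * ∏ x ∈ T', P b x := by
      rw [Finset.sum_eq_single_of_mem ∅ (Finset.empty_mem_powerset T')]
      · have e2 : insert c T' \ ({c} : Finset (Fin h)) = T' := by
          rw [Finset.insert_sdiff_of_mem _ (Finset.mem_singleton_self c), Finset.sdiff_singleton_eq_erase]
          exact Finset.erase_eq_of_notMem hcT'
        simp [hs, e2]
      · intro d hd hne
        obtain ⟨x, hx⟩ := Finset.nonempty_iff_ne_empty.mpr hne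
        have hxc : x ≠ c := fun e => hcT' (e ▸ Finset.mem_powerset.mp hd hx)
        rw [prod_basis_eq_zero P hs (Finset.mem_insert_of_mem hx) hxc, zero_mul, mul_zero]
    rw [h1, h2]
  · rw [if_neg hcT, add_zero, Finset.sum_eq_single_of_mem ∅ (Finset.empty_mem_powerset T)]
    · simp
    · intro d hd hne
      obtain ⟨x, hx⟩ := Finset.nonempty_iff_ne_empty.mpr hne
      have hxc : x ≠ c := fun e => hcT (e ▸ Finset.mem_powerset.mp hd hx)
      rw [prod_basis_eq_zero P hs hx hxc, zero_mul, mul_zero]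

/-- **The crowding combination vanishes on the columns inside `C`.**  For `T ⊆ C` and a point `b` (with the points `s c = e_c`, `c ∈ C`):
`Σ_{c∈C} P_{bc}·pairSum P (s c) b T − (1 + Σ_{c∈C} P_{bc})·(|T|!·P_b^T) + [T = ∅] = 0`. -/
theorem crowding_combination_apply (P : Fin h → Fin h → ℂ) (C : Finset (Fin h)) (s : Fin h → Fin h)
    (hs : ∀ c ∈ C, ∀ x, P (s c) x = if x = c then 1 else 0) (b : Fin h) {T : Finset (Fin h)} (hT : T ⊆ C) :
    (∑ c ∈ C, P b c * pairSum P (s c) b T) - (1 + ∑ c ∈ C, P b c) * ((T.card.factorial : ℂ) * ∏ x ∈ T, P b x) +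
      (if T = ∅ then 1 else 0) = 0 := by
  classical
  have e1 : ∑ c ∈ C, P b c * pairSum P (s c) b T =
      (∑ c ∈ C, P b c) * ((T.card.factorial : ℂ) * ∏ x ∈ T, P b x) +
        ∑ c ∈ C, (if c ∈ T then P b c * ((((T.card - 1).factorial : ℕ) : ℂ) * ∏ x ∈ T.erase c, P b x) else 0) := by
    rw [Finset.sum_mul, ← Finset.sum_add_distrib]
    refine Finset.sum_congr rfl fun c hc => ?_
    rw [pairSum_basis P (hs c hc) b T, mul_add]
    congr 1
    split_ifs <;> ring
  rw [e1, Finset.sum_ite_mem, Finset.inter_eq_right.mpr hT]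
  have e2 : ∑ c ∈ T, P b c * ((((T.card - 1).factorial : ℕ) : ℂ) * ∏ x ∈ T.erase c, P b x) =
      (T.card : ℂ) * ((((T.card - 1).factorial : ℕ) : ℂ) * ∏ x ∈ T, P b x) := by
    rw [Finset.sum_congr rfl fun c hc => by
      rw [mul_left_comm, Finset.mul_prod_erase T (fun x => P b x) hc], Finset.sum_const, nsmul_eq_mul]
  rw [e2]
  by_cases hT0 : T = ∅
  · subst hT0
    simp
  · rw [if_neg hT0]
    obtain ⟨n, hn⟩ : ∃ n, T.card = n + 1 :=
      ⟨T.card - 1, by have := Finset.card_pos.mpr (Finset.nonempty_iff_ne_empty.mpr hT0); omega⟩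
    rw [hn, Nat.add_sub_cancel, Nat.factorial_succ]
    push_cast
    ring

/-! ## 2. The no-go -/

/-- **Crowding kills the table (matrix form).**  If the table contains the basis vectors `e_c` (`c ∈ C`) as points `s c`, and a set `G`
of further points has more elements than there are benchmark columns NOT contained in `C`, then for every enumeration `uu` of the rows hitting
all sets of size `≤ 2` the segment-moment matrix has determinant `0`. -/
theorem det_segMatrix_eq_zero_of_crowding {r : ℕ} (P : Fin h → Fin h → ℂ) (C : Finset (Fin h)) (s : Fin h → Fin h)
    (hs : ∀ c ∈ C, ∀ x, P (s c) x = if x = c then 1 else 0) (G : Finset (Fin h)) (hG : ∀ b ∈ G, ∀ c ∈ C, s c ≠ b)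
    (hN : (Finset.univ.filter fun j : Fin r => ¬ benchCols h r j ⊆ C).card < G.card)
    (uu : Fin r → Finset (Fin h)) (hsurj : ∀ S : Finset (Fin h), S.card ≤ 2 → ∃ i, uu i = S) :
    (segMatrix r P uu).det = 0 := by
  classical
  set M := segMatrix r P uu with hM
  -- row indices
  have card2 : ∀ p q : Fin h, p ≠ q → ({p, q} : Finset (Fin h)).card ≤ 2 := fun p q hpq => by rw [Finset.card_pair hpq]
  obtain ⟨i0, hi0⟩ := hsurj ∅ (by simp)
  have hib : ∀ b : Fin h, ∃ i, uu i = {b} := fun b => hsurj {b} (by simp)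
  choose ib hib using hib
  have hip : ∀ cb : Fin h × Fin h, s cb.1 ≠ cb.2 → ∃ i, uu i = {s cb.1, cb.2} := fun cb hne => hsurj _ (card2 _ _ hne)
  -- a total choice (junk where `s c = b`)
  have hip' : ∀ cb : Fin h × Fin h, ∃ i, s cb.1 ≠ cb.2 → uu i = {s cb.1, cb.2} := by
    intro cb
    by_cases hne : s cb.1 ≠ cb.2
    · obtain ⟨i, hi⟩ := hip cb hne; exact ⟨i, fun _ => hi⟩
    · exact ⟨i0, fun h' => absurd h' hne⟩
  choose ip hip' using hip'
  -- the combinations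
  let w : Fin h → (Fin r → ℂ) := fun b =>
    ∑ c ∈ C, P b c • Pi.single (ip (c, b)) (1 : ℂ) - (1 + ∑ c ∈ C, P b c) • Pi.single (ib b) (1 : ℂ) + Pi.single i0 (1 : ℂ)
  -- (1) each combination vanishes on the columns inside C
  have hw : ∀ b ∈ G, ∀ j : Fin r, benchCols h r j ⊆ C → Matrix.vecMul (w b) M j = 0 := by
    intro b hb j hT
    simp only [w, Matrix.add_vecMul, Matrix.sub_vecMul, Matrix.sum_vecMul, Matrix.smul_vecMul, Matrix.single_one_vecMul,
      Pi.add_apply, Pi.sub_apply, Finset.sum_apply, Pi.smul_apply, smul_eq_mul, Matrix.row_apply]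
    have epair : ∀ c ∈ C, M (ip (c, b)) j = pairSum P (s c) b (benchCols h r j) := fun c hc =>
      segMatrix_row_pair P uu (hG b hb c hc) (hip' (c, b) (hG b hb c hc)) j
    have esing : M (ib b) j = ((benchCols h r j).card.factorial : ℂ) * ∏ x ∈ benchCols h r j, P b x := by
      have := congr_fun (segMatrix_row_singleton P uu (hib b)) j
      rw [Matrix.row_apply] at this
      rw [hM, this]; rfl
    have eempty : M i0 j = if benchCols h r j = ∅ then 1 else 0 := by
      have := congr_fun (segMatrix_row_empty P uu hi0) j
      rw [Matrix.row_apply] at this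
      rw [hM, this]; rfl
    rw [Finset.sum_congr rfl fun c hc => by rw [epair c hc], esing, eempty]
    exact crowding_combination_apply P C s hs b hT
  -- (2) the crowded map
  let J : Type := {j : Fin r // ¬ benchCols h r j ⊆ C}
  let Wm : Matrix ↥G (Fin r) ℂ := fun b i => w b.1 i
  let Φ : (↥G → ℂ) →ₗ[ℂ] (J → ℂ) :=
    { toFun := fun μ j => Matrix.vecMul (Matrix.vecMul μ Wm) M j.1
      map_add' := fun μ ν => by
        funext j; simp only [Matrix.add_vecMul, Pi.add_apply]
      map_smul' := fun a μ => by
        funext j; simp only [Matrix.smul_vecMul, Pi.smul_apply, RingHom.id_apply] }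
  have hdim : finrank ℂ (J → ℂ) < finrank ℂ (↥G → ℂ) := by
    rw [finrank_fintype_fun_eq_card, finrank_fintype_fun_eq_card, Fintype.card_coe]
    rw [Fintype.card_subtype]
    exact hN
  obtain ⟨μ, hμker, hμ0⟩ : ∃ μ ∈ LinearMap.ker Φ, μ ≠ 0 :=
    Submodule.exists_mem_ne_zero_of_ne_bot (LinearMap.ker_ne_bot_of_finrank_lt hdim)
  -- the kernel vector of M
  let v : Fin r → ℂ := Matrix.vecMul μ Wm
  have hvM : Matrix.vecMul v M = 0 := by
    funext j
    by_cases hj : benchCols h r j ⊆ C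
    · -- columns inside C: each combination vanishes there
      show Matrix.vecMul (Matrix.vecMul μ Wm) M j = 0
      have e : Matrix.vecMul (Matrix.vecMul μ Wm) M j = ∑ b : ↥G, μ b * Matrix.vecMul (w b.1) M j := by
        simp only [Matrix.vecMul, dotProduct, Wm, Finset.sum_mul, Finset.mul_sum, mul_assoc]
        rw [Finset.sum_comm]
      rw [e]
      exact Finset.sum_eq_zero fun b _ => by rw [hw b.1 b.2 j hj, mul_zero]
    · exact congr_fun (LinearMap.mem_ker.mp hμker) ⟨j, hj⟩
  have hv0 : v ≠ 0 := by
    intro hv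
    apply hμ0
    funext b
    -- evaluate v at the private coordinates of b
    have pair_ne_single : ∀ (c : Fin h) (b' b'' : Fin h), s c ≠ b' → ip (c, b') ≠ ib b'' := by
      intro c b' b'' hne e
      have := (hip' (c, b') hne).symm.trans ((congrArg uu e).trans (hib b''))
      have hc : s c ∈ ({b''} : Finset (Fin h)) := by rw [← this]; simp
      have hb : b' ∈ ({b''} : Finset (Fin h)) := by rw [← this]; simp
      rw [Finset.mem_singleton] at hc hb
      exact hne (hc.trans hb.symm)
    have empty_ne_single : ∀ b'' : Fin h, i0 ≠ ib b'' := by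
      intro b'' e
      have := hi0.symm.trans ((congrArg uu e).trans (hib b''))
      exact (Finset.singleton_ne_empty b'').symm this
    have single_inj : ∀ b' b'' : Fin h, ib b' = ib b'' → b' = b'' := by
      intro b' b'' e
      have := (hib b').symm.trans ((congrArg uu e).trans (hib b''))
      exact Finset.singleton_injective this
    have empty_ne_pair : ∀ (c b' : Fin h), s c ≠ b' → i0 ≠ ip (c, b') := by
      intro c b' hne e
      have := hi0.symm.trans ((congrArg uu e).trans (hip' (c, b') hne))
      have : s c ∈ (∅ : Finset (Fin h)) := by rw [this]; simp
      simp at this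
    have pair_inj : ∀ (c c' b' b'' : Fin h), s c ≠ b' → s c' ≠ b'' → b' ∈ G → b'' ∈ G → c ∈ C → c' ∈ C →
        ip (c, b') = ip (c', b'') → b' = b'' ∧ c = c' := by
      intro c c' b' b'' hne hne' hb' hb'' hc hc' e
      have := (hip' (c, b') hne).symm.trans ((congrArg uu e).trans (hip' (c', b'') hne'))
      rcases pair_eq_pair_iff (s c) b' (s c') b'' this with ⟨h1, h2⟩ | ⟨h1, h2⟩
      · refine ⟨h2, ?_⟩
        have e1 := hs c hc c
        rw [h1, hs c' hc' c, if_pos rfl] at e1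
        by_contra hcc
        rw [if_neg hcc] at e1
        exact zero_ne_one e1
      · exact absurd h1 (hG b'' hb'' c hc)
    -- coordinate `ib b`
    have hvb : v (ib b) = -(μ b * (1 + ∑ c ∈ C, P b c)) := by
      simp only [v, Matrix.vecMul, dotProduct, Wm, w, Pi.add_apply, Pi.sub_apply, Finset.sum_apply, Pi.smul_apply,
        smul_eq_mul]
      have : ∀ b' : ↥G, μ b' * (∑ c ∈ C, P b' c * (Pi.single (ip (c, b')) (1 : ℂ) : Fin r → ℂ) (ib b) -
          (1 + ∑ c ∈ C, P b' c) * (Pi.single (ib b') (1 : ℂ) : Fin r → ℂ) (ib b) +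
            (Pi.single i0 (1 : ℂ) : Fin r → ℂ) (ib b)) =
          if b' = b then -(μ b * (1 + ∑ c ∈ C, P b c)) else 0 := by
        intro b'
        have hsum0 : ∑ c ∈ C, P b' c * (Pi.single (ip (c, b')) (1 : ℂ) : Fin r → ℂ) (ib b) = 0 :=
          Finset.sum_eq_zero fun c hc => by
            rw [Pi.single_eq_of_ne (Ne.symm (pair_ne_single c b' b (hG b' b'.2 c hc))), mul_zero]
        rw [hsum0, Pi.single_eq_of_ne (Ne.symm (empty_ne_single b)), zero_sub, add_zero]
        by_cases hb' : b' = b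
        · rw [if_pos hb', hb', Pi.single_eq_same]
          ring
        · have hne : ib b ≠ ib (b' : Fin h) := fun e => hb' (Subtype.ext (single_inj _ _ e).symm)
          rw [if_neg hb', Pi.single_eq_of_ne hne]
          ring
      rw [Finset.sum_congr rfl fun b' _ => this b', Finset.sum_ite_eq' Finset.univ b]
      simp
    -- coordinates `ip (c, b)`
    have hvcb : ∀ c ∈ C, v (ip (c, b)) = μ b * P b c := by
      intro c hc
      simp only [v, Matrix.vecMul, dotProduct, Wm, w, Pi.add_apply, Pi.sub_apply, Finset.sum_apply, Pi.smul_apply,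
        smul_eq_mul]
      have : ∀ b' : ↥G, μ b' * (∑ c' ∈ C, P b' c' * (Pi.single (ip (c', b')) (1 : ℂ) : Fin r → ℂ) (ip (c, b)) -
          (1 + ∑ c' ∈ C, P b' c') * (Pi.single (ib b') (1 : ℂ) : Fin r → ℂ) (ip (c, b)) +
            (Pi.single i0 (1 : ℂ) : Fin r → ℂ) (ip (c, b))) =
          if b' = b then μ b * P b c else 0 := by
        intro b'
        rw [Pi.single_eq_of_ne (pair_ne_single c b b' (hG b b.2 c hc)),
          Pi.single_eq_of_ne (Ne.symm (empty_ne_pair c b (hG b b.2 c hc))), mul_zero, sub_zero, add_zero]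
        by_cases hb' : b' = b
        · rw [if_pos hb', hb']
          rw [Finset.sum_eq_single_of_mem c hc (fun c' hc' hne => by
            rw [Pi.single_eq_of_ne (fun e => hne (pair_inj c c' b b (hG b b.2 c hc) (hG b b.2 c' hc') b.2 b.2 hc hc' e).2.symm),
              mul_zero])]
          rw [Pi.single_eq_same, mul_one]
        · rw [if_neg hb', Finset.sum_eq_zero (fun c' hc' => by
            rw [Pi.single_eq_of_ne (fun e => hb' (Subtype.ext (pair_inj c c' b b' (hG b b.2 c hc) (hG b' b'.2 c' hc')
              b.2 b'.2 hc hc' e).1.symm)), mul_zero]), mul_zero]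
      rw [Finset.sum_congr rfl fun b' _ => this b', Finset.sum_ite_eq' Finset.univ b]
      simp
    -- conclude μ b = 0
    have e0 : μ b * (1 + ∑ c ∈ C, P b c) = 0 := by
      have := congr_fun hv (ib b); rw [hvb] at this; simpa using this
    have e1 : ∀ c ∈ C, μ b * P b c = 0 := fun c hc => by
      have := congr_fun hv (ip (c, b)); rwa [hvcb c hc] at this
    have : μ b = μ b * (1 + ∑ c ∈ C, P b c) - ∑ c ∈ C, μ b * P b c := by
      rw [← Finset.mul_sum]; ring
    rw [this, e0, Finset.sum_eq_zero e1, sub_zero]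
    rfl
  exact (Matrix.exists_vecMul_eq_zero_iff).mp ⟨v, hv0, hvM⟩

/-- **Crowding — the line's form.**  A table containing the basis vectors of the coordinates in `C` together with more than `N` further points,
`N` = the number of benchmark columns not inside `C`, is never a witness of `stub_segmentMeanValue` / `stub_s10` / `stub_zeroOneDesign`. -/
theorem det_eq_zero_of_crowding {r : ℕ} (P : Fin h → Fin h → ℂ) (C : Finset (Fin h)) (s : Fin h → Fin h)
    (hs : ∀ c ∈ C, ∀ x, P (s c) x = if x = c then 1 else 0) (G : Finset (Fin h)) (hG : ∀ b ∈ G, ∀ c ∈ C, s c ≠ b)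
    (hN : (Finset.univ.filter fun j : Fin r => ¬ benchCols h r j ⊆ C).card < G.card)
    (uu : Fin r → Finset (Fin h)) (hsurj : ∀ S : Finset (Fin h), S.card ≤ 2 → ∃ i, uu i = S) :
    (Matrix.of fun i j : Fin r =>
      ∑ g : (↥(benchCols h r j) → ↥(uu i)), (∏ c : ↥(benchCols h r j), P (g c) c) *
        ∏ a : ↥(uu i), ((Finset.univ.filter fun c : ↥(benchCols h r j) => g c = a).card.factorial : ℂ)).det = 0 :=
  det_segMatrix_eq_zero_of_crowding P C s hs G hG hN uu hsurj

end

end Summit.ValiantsHypothesis.ValiantsHypothesis.Theorems.BarrierLever.ChowBenchmarkHyperplane
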